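import Summits.QuantumFields.YangMills.Theorems.UnitScaleTiltHistoryTailOfPackagePinnedLf
import Summits.QuantumFields.YangMills.Theorems.UV3PinnedStepV3FaceOfPackageV3
import Summits.QuantumFields.YangMills.Theorems.UV3PinnedStepKnitOfPackageV3
import Summits.QuantumFields.YangMills.Theorems.UV3UnitEnvelopeFaceOfPackageV3
import Summits.QuantumFields.YangMills.Theorems.UV3PinnedStepOrganOfMassEnvelopeV3
import Summits.QuantumFields.YangMills.Theorems.UV3UnitEnvelopeOrganOfMassEnvelopeV3
import Summits.QuantumFields.YangMills.Theorems.UnitScaleTiltHistoryTailOfPinnedHeightTailFreeRate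
import HarnessLib

/-!
# THE 19936 CRUX FACE IN THE v3 CURRENCY — `UnitScaleTilt.HistoryTailL` FROM THE v3 T3 (α) SOCKET, THE POLYMER FIELDS AND ONE UV3-NODE RESIDUAL ROW hJ(v3)
# (the top-level a.e. mass envelope of the windowed pinned masses `massP`): TWO displayed organ-free rows, no `hMain`, no `hTriv`

Cell `ym3-torus` (YM ladder rung R3 = continuum `SU(2)` Yang–Mills on the three-torus — a RUNG, NOT d = 4, NOT infinite volume, NOT a mass gap, NOT Clay).
Twin-width seat `ym-ust-19936-w8` (gen 11); `--supports stmt-QuantumFields-19936 --as helper`, count-neutral, definition-free, default heartbeats.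
Crux `UnitScaleTilt.HistoryTailL` (stmt-QuantumFields-19936), skeleton of record `Cruxes/HistoryTailL/Lines/pinned_stability.lean` v3 (de3325bf; R-a′ letters).  ★★OWNER RECORD 17bf: the v1-currency
face of record is ✓`UnitScaleTiltHistoryTailOfPackageMassEnvelope.historyTailL_of_package_of_massEnvelope_of_main (hpkg)(π)(hMain)(hJ)(hTriv)`; this file is its v3 twin — «hJ's honest
home» (`ym-ust-19936-w6` g7 LOCATE-S-ORGAN §5, ★★OWNER WORD 58 (e)): the v3 masses `massP` have no floor at the trivial history, so `hTriv` disappears, and the v3 (47)-half needs no membership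
row, so `hMain` disappears.  **A CONDITIONAL THEOREM WITH DISPLAYED ROWS.  IT DOES NOT PROVE `HistoryTailL`.**

THE CHAIN, ALL BY NAME (v3 socket `AlphaInputsT3AC.OfV3At`, record `PkgAtV3`, datum `dataT3v3`):
* S: `stub_pinnedStep` (v3 text) ⟸ ✓`UV3PinnedStepV3FaceOfPackageV3.stub_pinnedStepV3_of_packageV3_of_purePinTop (hpkg)(π)(hPinA)` (this seat) ⟸ ✓`UV3PinnedStepKnitOfPackageV3.hPinA_of_pinnedLF_v3 (π)(hSii)`
  (`ym3-torus-px8` g11, v3 BRICKS) ⟸ ✓`UV3PinnedStepOrganOfMassEnvelopeV3` `AlphaInputsT3AC.OfV3At.hSii_of_massEnvelope (h)(hc)(γ hγ hγ1)(m)(hJ)` (`ym-ust-19936-w6` g7, T1–T6 over the v3 record);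
* U: `stub_unitEnvelope` ⟸ ✓`UV3UnitEnvelopeFaceOfPackageV3.stub_unitEnvelope_of_packageV3_of_lfTop_ae (hpkg)(π)(hlf)` (`ym3-torus-px12` g13) ⟸ ✓`UV3UnitEnvelopeOrganOfMassEnvelopeV3`
  `AlphaInputsT3AC.OfV3At.hlf_ae_of_massEnvelope (h)(hc)(γ hγ hγ1)(π)(hJ)` (w6 g7, §U-v3: `wtP ≤ massP`, `massP triv = 1`);
* door: ✓`UnitScaleTiltHistoryTailOfPackagePinnedLf.pinnedHeightTail_of'` (S-step v3 → S-low → `hP′`); socket: the LEAD's K-19′ ✓`historyTailL_of_pinnedHeightTail_freeRate`.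
★★★★ `historyTailL_of_packageV3_of_massEnvelope (hpkg) (π) (hJ) : …Theses.UnitScaleTilt.HistoryTailL`.

THE ROWS DISPLAYED.  `hpkg : ∀ L, 1 < L → ∃ 𝔠 a₀ a₁, (0 < a₀ ∧ 0 < a₁ ∧ 𝔠.B₃·a₁ ≤ a₀) ∧ ∀ F (hF : F.L = L), OfV3At F (hF ▸ 𝔠) a₀ a₁` — the UV3 node's v3 (α) package (hypothesis schema; GUARDED,
★★OWNER RULING №38); `π` — polymer fields (data); `hJ` — per `(F, 𝔠, a₀, a₁, h, hc, γ)`: `∃ A₁, ∀ K r, Admissible r → r ≠ triv → ∀ᵐ W, massP 𝔠.lane (h.pkgAtV3 hc γ hγ hγ1 K).X K r W ≤ e^{A₁}` — «the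
K-fold transported (windowed, pinned) history mass of `blockAvg ℰp` is essentially bounded at the unit lattice, uniformly in the run»: in print `≤ 1` by the Haar compatibility of the averaging;
OPEN for the tree's `ℰp` (lit GAPS G-B10-10(c); the `dag-n08-d` target of ★★OWNER WORD 64).

HONEST SCOPE.  A face; closes nothing — hJ and the socket are displayed, not proved; nothing of `stub_pinnedStep`, `stub_unitEnvelope`, `hP′`, `HistoryTailL` (19936) or the rung is proved here.
Sorry-free, axioms standard.

References: T. Bałaban, *Ultraviolet stability of three-dimensional lattice pure gauge field theories*, Commun. Math. Phys. **102** (1985) 255–275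
[Balaban1985UV3] ((2) p.256, (5)–(7) pp.256–257, (41) p.266, (46)–(47) p.267, (64) p.273, (67), (70)–(71) p.273, pp.273–274).
-/

set_option autoImplicit false

noncomputable section

namespace Summit.QuantumFields.YangMills.Theorems.UnitScaleTiltHistoryTailOfPackageV3MassEnvelope

open scoped BigOperators
open MeasureTheory
open Literature.MathematicalPhysics.QuantumFieldTheory.Balaban1983to89
open Literature.MathematicalPhysics.QuantumFieldTheory.Balaban1983to89.T3ContinuumYM3Torus
open Literature.MathematicalPhysics.QuantumFieldTheory.Balaban1983to89.T3UnitScaleTilt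
open Literature.MathematicalPhysics.QuantumFieldTheory.Balaban1983to89.T3UnitLawDensityEML
open Literature.MathematicalPhysics.QuantumFieldTheory.Balaban1983to89.T3RestrictedUnitDensity
open Literature.MathematicalPhysics.QuantumFieldTheory.Balaban1983to89.T3AlphaInputsAC
open Literature.MathematicalPhysics.QuantumFieldTheory.Balaban1983to89.Missing (partitionFn)
open Literature.MathematicalPhysics.QuantumFieldTheory.Balaban1985CMP102
open Literature.MathematicalPhysics.QuantumFieldTheory.Balaban1985CMP102.Setting
open Summit.QuantumFields.Balaban3D.Carriers
open Summit.QuantumFields.Balaban3D.Proofs.Primitives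
open Summit.QuantumFields.Balaban3D.Proofs.StandardAC
open Summit.QuantumFields.Balaban3D.Proofs.InputsAC
open Summit.QuantumFields.YangMills.Theorems.UnitScaleTiltHistoryTailOfPackagePinnedLf (pinnedHeightTail_of')
open Summit.QuantumFields.YangMills.Theorems.UV3PinnedStepV3FaceOfPackageV3 (stub_pinnedStepV3_of_packageV3_of_purePinTop)
open Summit.QuantumFields.YangMills.Theorems.UV3PinnedStepKnitOfPackageV3 (hPinA_of_pinnedLF_v3)
open Summit.QuantumFields.YangMills.Theorems.UV3UnitEnvelopeFaceOfPackageV3 (stub_unitEnvelope_of_packageV3_of_lfTop_ae)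
open Summit.QuantumFields.YangMills.Theorems.UnitScaleTiltHistoryTailOfPinnedHeightTailFreeRate (historyTailL_of_pinnedHeightTail_freeRate)

open Classical in
/-- ★★★★ **`UnitScaleTilt.HistoryTailL` FROM THE v3 (α) SOCKET, THE POLYMER FIELDS AND THE TOP-LEVEL A.E. MASS ENVELOPE hJ(v3)** — the v3 twin of the face of record
✓`UnitScaleTiltHistoryTailOfPackageMassEnvelope.historyTailL_of_package_of_massEnvelope_of_main`: no `hMain` (the v3 (47)-half carries its own membership row), no `hTriv` (`massP triv = 1`).
S ⟸ S-face ∘ v3-KNIT ∘ w6's v3 `hSii_of_massEnvelope`; U ⟸ px12's a.e. U-face ∘ w6's v3 `hlf_ae_of_massEnvelope`; door `pinnedHeightTail_of'`; the LEAD's K-19′ socket.  CONDITIONAL — a face; it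
does NOT prove `HistoryTailL`. [cite: Balaban1985UV3, Thm 1 (5) p.256, (41) p.266, (47) p.267, (67), (70)-(71) p.273, pp.273-274] -/
theorem historyTailL_of_packageV3_of_massEnvelope
    (hpkg : ∀ L : ℕ, 1 < L → ∃ (𝔠 : AlphaConsts L (suGroupModel 2).N) (a₀ a₁ : ℝ),
      (0 < a₀ ∧ 0 < a₁ ∧ 𝔠.B₃ * a₁ ≤ a₀) ∧ ∀ (F : T3Family) (hF : F.L = L), AlphaInputsT3AC.OfV3At F (hF ▸ 𝔠) a₀ a₁)
    (π : ∀ F : T3Family, AlphaInputsT3AC.PolymerT3 F)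
    (hJ : ∀ (F : T3Family) (𝔠 : AlphaConsts F.L (suGroupModel 2).N) (a₀ a₁ : ℝ) (h : AlphaInputsT3AC.OfV3At F 𝔠 a₀ a₁)
      (hc : 0 < a₀ ∧ 0 < a₁ ∧ 𝔠.B₃ * a₁ ≤ a₀) (γ : ℝ) (hγ : 0 < γ) (hγ1 : γ ≤ (min 𝔠.gamma0 1) ^ 2),
      ∃ A₁ : ℝ, ∀ (K : ℕ) (r : Hist (F.P K) K),
        Hist.Admissible 𝔠.lane.carrier.M₁ (rcolOf (T3Scales F γ hγ (hγ1.trans (sq_min_one_le _ 𝔠.gamma0_pos)) K) 𝔠.lane.carrier) K r →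
        r ≠ Hist.triv (F.P K) K →
        ∀ᵐ W ∂(fieldMeasure (F.P K) K (Matrix.specialUnitaryGroup (Fin 2) ℂ)),
          PinnedStep.massP 𝔠.lane (h.pkgAtV3 hc γ hγ hγ1 K).X K r W ≤ Real.exp A₁) :
    Summit.QuantumFields.YangMills.Theses.UnitScaleTilt.HistoryTailL :=
  historyTailL_of_pinnedHeightTail_freeRate
    (pinnedHeightTail_of'
      (stub_pinnedStepV3_of_packageV3_of_purePinTop hpkg π
        (hPinA_of_pinnedLF_v3 π fun _ 𝔠 a₀ a₁ _ hOf m _ =>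
          ⟨1, one_pos, fun F hF hc' γ hγ hγ1' _ =>
            (hOf F hF).hSii_of_massEnvelope hc' γ hγ hγ1' m (hJ F (hF ▸ 𝔠) a₀ a₁ (hOf F hF) hc' γ hγ hγ1')⟩))
      (stub_unitEnvelope_of_packageV3_of_lfTop_ae hpkg π fun F 𝔠 a₀ a₁ h hc γ hγ hγ1 =>
        h.hlf_ae_of_massEnvelope hc γ hγ hγ1 (π F) (hJ F 𝔠 a₀ a₁ h hc γ hγ hγ1)))

end Summit.QuantumFields.YangMills.Theorems.UnitScaleTiltHistoryTailOfPackageV3MassEnvelope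

end
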